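import Summits.Ventures.DiscreteObjects.PP12.PrimeOrderStructure

/-!
# Baer's equality: a collineation of a finite projective plane fixes as many lines as points (kernel, general order)
Framing: lottery ticket; floor = certified bounds/negative ranges.

**Theorem (`fixedCard_points_eq_lines`).** For every collineation `σ` of a finite projective plane (Mathlib
`Configuration.ProjectivePlane`), the number of fixed points equals the number of fixed lines. Classical (R. Baer 1947;
Hughes–Piper, *Projective Planes*, Thm 13.4 via permutation characters; Dembowski 1968 §1.3); formalised here because the
census cell `pub-namedobj` (target M) needs it to pin `f = g` in the flag-type case of `OrderThree.lean` and had so far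
re-derived each line count by a separate dual argument.

Proof (trace identity over `ℕ`, no inverses): with the incidence matrix `N` (`P × L`), the permutation matrices `A` (points)
and `B` (lines) of `σ` satisfy `A N = N B` (incidence is preserved); `N Nᵀ = n·1 + J` and `Nᵀ N = n·1 + J` (two points on
one line, two lines through one point); hence `trace (A N Nᵀ) = n·f + v` and, by cyclicity of the trace,
`trace (A N Nᵀ) = trace (B Nᵀ N) = n·g + v`, so `f = g`.
-/

namespace Summit.Ventures.DiscreteObjects.PP12

open Configuration Finset Matrix
open scoped Classical

namespace Collineation

variable {P L : Type*} [Membership P L] [ProjectivePlane P L] [Fintype P] [Fintype L]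
  [DecidableEq P] [DecidableEq L] (σ : Collineation P L)

omit [DecidableEq L] in
/-- number of common lines of two points: `n + 1` on the diagonal, `1` off it -/
theorem card_common_lines (p q : P) :
    (univ.filter fun l : L => p ∈ l ∧ q ∈ l).card = if p = q then ProjectivePlane.order P L + 1 else 1 := by
  split_ifs with h
  · subst h
    have : (univ.filter fun l : L => p ∈ l ∧ p ∈ l) = univ.filter fun l : L => p ∈ l := by
      ext l; simp
    rw [this, ← Fintype.card_subtype, ← Nat.card_eq_fintype_card]
    exact ProjectivePlane.lineCount_eq L p
  · rw [Finset.card_eq_one]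
    refine ⟨HasLines.mkLine h, ?_⟩
    ext l
    simp only [mem_filter, mem_univ, true_and, mem_singleton]
    constructor
    · rintro ⟨h1, h2⟩
      exact (Nondegenerate.eq_or_eq h1 h2 (HasLines.mkLine_ax h).1 (HasLines.mkLine_ax h).2).resolve_left h
    · rintro rfl; exact HasLines.mkLine_ax h

omit [DecidableEq P] in
/-- number of common points of two lines: `n + 1` on the diagonal, `1` off it -/
theorem card_common_points (l m : L) :
    (univ.filter fun p : P => p ∈ l ∧ p ∈ m).card = if l = m then ProjectivePlane.order P L + 1 else 1 := by
  split_ifs with h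
  · subst h
    have : (univ.filter fun p : P => p ∈ l ∧ p ∈ l) = univ.filter fun p : P => p ∈ l := by
      ext p; simp
    rw [this, ← Fintype.card_subtype, ← Nat.card_eq_fintype_card]
    exact ProjectivePlane.pointCount_eq P l
  · rw [Finset.card_eq_one]
    refine ⟨HasPoints.mkPoint h, ?_⟩
    ext p
    simp only [mem_filter, mem_univ, true_and, mem_singleton]
    constructor
    · rintro ⟨h1, h2⟩
      exact (Nondegenerate.eq_or_eq h1 (HasPoints.mkPoint_ax h).1 h2 (HasPoints.mkPoint_ax h).2).resolve_right h
    · rintro rfl; exact HasPoints.mkPoint_ax h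

/-- **Baer's equality.** A collineation of a finite projective plane fixes as many lines as points. -/
theorem fixedCard_points_eq_lines : fixedCard σ.onPoints = fixedCard σ.onLines := by
  -- the incidence matrix and the two permutation matrices, over ℕ
  set N : Matrix P L ℕ := Matrix.of fun p l => if p ∈ l then 1 else 0 with hN
  set A : Matrix P P ℕ := Matrix.of fun p q => if σ.onPoints p = q then 1 else 0 with hA
  set B : Matrix L L ℕ := Matrix.of fun l m => if σ.onLines l = m then 1 else 0 with hB
  -- (1) A N = N B: incidence is preserved
  have hAN : A * N = N * B := by
    ext p l
    simp only [hA, hB, hN, Matrix.mul_apply, Matrix.of_apply]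
    have hl : ∀ q : P, (if σ.onPoints p = q then 1 else 0) * (if q ∈ l then 1 else 0)
        = if σ.onPoints p = q then (if q ∈ l then 1 else 0) else 0 := by
      intro q; split_ifs <;> simp
    rw [Finset.sum_congr rfl (fun q _ => hl q), Finset.sum_ite_eq univ (σ.onPoints p) (fun q => if q ∈ l then 1 else 0)]
    simp only [mem_univ, if_true]
    have hr : ∀ l' : L, (if p ∈ l' then 1 else 0) * (if σ.onLines l' = l then 1 else 0)
        = if l' = σ.onLines.symm l then (if p ∈ l' then 1 else 0) else 0 := by
      intro l'
      by_cases h : l' = σ.onLines.symm l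
      · subst h; simp
      · have : σ.onLines l' ≠ l := fun e => h (by rw [← e]; simp)
        simp [h, this]
    rw [Finset.sum_congr rfl (fun l' _ => hr l'), Finset.sum_ite_eq' univ (σ.onLines.symm l)]
    simp only [mem_univ, if_true]
    have : p ∈ σ.onLines.symm l ↔ σ.onPoints p ∈ l := by
      have := σ.mem_iff p (σ.onLines.symm l)
      simp only [Equiv.apply_symm_apply] at this
      exact this.symm
    by_cases h : σ.onPoints p ∈ l
    · rw [if_pos h, if_pos (this.mpr h)]
    · rw [if_neg h, if_neg (fun h' => h (this.mp h'))]
  -- (2) the Gram identities N Nᵀ = n·1 + J and Nᵀ N = n·1 + J, entrywise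
  have hNNt : ∀ q p : P, (N * Nᵀ) q p = if q = p then ProjectivePlane.order P L + 1 else 1 := by
    intro q p
    simp only [hN, Matrix.mul_apply, Matrix.transpose_apply, Matrix.of_apply]
    rw [← card_common_lines (L := L) q p, Finset.card_filter]
    refine Finset.sum_congr rfl fun l _ => ?_
    by_cases h1 : q ∈ l <;> by_cases h2 : p ∈ l <;> simp [h1, h2]
  have hNtN : ∀ m l : L, (Nᵀ * N) m l = if m = l then ProjectivePlane.order P L + 1 else 1 := by
    intro m l
    simp only [hN, Matrix.mul_apply, Matrix.transpose_apply, Matrix.of_apply]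
    rw [← card_common_points (P := P) m l, Finset.card_filter]
    refine Finset.sum_congr rfl fun p _ => ?_
    by_cases h1 : p ∈ m <;> by_cases h2 : p ∈ l <;> simp [h1, h2]
  -- (3) trace (A N Nᵀ) = n·f + v
  have htrA : Matrix.trace (A * (N * Nᵀ)) = ProjectivePlane.order P L * fixedCard σ.onPoints + Fintype.card P := by
    simp only [Matrix.trace, Matrix.diag]
    have hdiag : ∀ p : P, (A * (N * Nᵀ)) p p = if σ.onPoints p = p then ProjectivePlane.order P L + 1 else 1 := by
      intro p
      rw [Matrix.mul_apply]
      have hterm : ∀ q : P, A p q * (N * Nᵀ) q p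
          = if σ.onPoints p = q then (if q = p then ProjectivePlane.order P L + 1 else 1) else 0 := by
        intro q
        rw [hNNt q p]
        simp only [hA, Matrix.of_apply]
        split_ifs <;> simp
      rw [Finset.sum_congr rfl (fun q _ => hterm q), Finset.sum_ite_eq]
      simp
    rw [Finset.sum_congr rfl (fun p _ => hdiag p)]
    rw [Finset.sum_ite, Finset.sum_const, Finset.sum_const, smul_eq_mul, smul_eq_mul]
    unfold fixedCard
    have hsplit := Finset.card_filter_add_card_filter_not (s := (univ : Finset P)) (fun p : P => σ.onPoints p = p)
    rw [Finset.card_univ] at hsplit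
    rw [← hsplit]
    ring
  -- (4) trace (B Nᵀ N) = n·g + v
  have htrB : Matrix.trace (B * (Nᵀ * N)) = ProjectivePlane.order P L * fixedCard σ.onLines + Fintype.card L := by
    simp only [Matrix.trace, Matrix.diag]
    have hdiag : ∀ l : L, (B * (Nᵀ * N)) l l = if σ.onLines l = l then ProjectivePlane.order P L + 1 else 1 := by
      intro l
      rw [Matrix.mul_apply]
      have hterm : ∀ m : L, B l m * (Nᵀ * N) m l
          = if σ.onLines l = m then (if m = l then ProjectivePlane.order P L + 1 else 1) else 0 := by
        intro m
        rw [hNtN m l]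
        simp only [hB, Matrix.of_apply]
        split_ifs <;> simp
      rw [Finset.sum_congr rfl (fun m _ => hterm m), Finset.sum_ite_eq]
      simp
    rw [Finset.sum_congr rfl (fun l _ => hdiag l)]
    rw [Finset.sum_ite, Finset.sum_const, Finset.sum_const, smul_eq_mul, smul_eq_mul]
    unfold fixedCard
    have hsplit := Finset.card_filter_add_card_filter_not (s := (univ : Finset L)) (fun l : L => σ.onLines l = l)
    rw [Finset.card_univ] at hsplit
    rw [← hsplit]
    ring
  -- (5) cyclicity of the trace
  have hcyc : Matrix.trace (A * (N * Nᵀ)) = Matrix.trace (B * (Nᵀ * N)) := by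
    rw [← Matrix.mul_assoc, hAN, Matrix.mul_assoc, Matrix.trace_mul_comm, Matrix.mul_assoc]
  rw [hcyc, htrB, ProjectivePlane.card_points P L, ProjectivePlane.card_lines P L] at htrA
  have hpos : 0 < ProjectivePlane.order P L := lt_trans zero_lt_one (ProjectivePlane.one_lt_order P L)
  have := Nat.eq_of_mul_eq_mul_left hpos (by omega : ProjectivePlane.order P L * fixedCard σ.onLines
    = ProjectivePlane.order P L * fixedCard σ.onPoints)
  exact this.symm

end Collineation

end Summit.Ventures.DiscreteObjects.PP12
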